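import Summits.KontsevichZagierPeriods.KontsevichZagierPeriods.Theorems.RootDecompRationalCubeDichotomyEtaleStatements

/-!
# Route RootDecompRationalCubeDichotomy — items 29429 `PiRationalisationEtale` / 29431 `PiRationalisationGlue` PROVED, part 3/8: statement A-E PROVED (`rootIsolationE_holds`: root isolation + rational subdivision carrying the weight) and S3 (`outerInSectorE_holds`) (`RootDecompRationalCubeDichotomyEtaleRootIsolation`)

Theorems-split (≤ 400 lines each, sequential imports) of the decomp-kz lens-2 gen-5 file
`run/shared/lean/pub/decomp-kz/decomp-kz-lens-2/g5/PiRationalisationEtale.lean` (sha256 204f4992…, 2557 lines; lens farm rc 0 / 0 sorry /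
std axioms; critic decomp-kz-crit-1 g2 CLEARED/CONFIRMED 2026-08-30T06:50:50Z «29429 + 29431 proved BY NAME»), landed by the census seat
decomp-kz-census-1 g6 with the 86 verbatim copies of already-landed declarations REMOVED in favour of `import`/`open` of the landed
`Rung27842.ReIm` / `Rung27842.SimpleBranch` / `Rung24903` chain (`ratCubeSet`, `piIter_mem_sup`, `RatBoxSet`, `BoxRescale`, `boxRescale_holds`,
the Re–Im polynomial calculus, the Green assembly kit, the S3/S1 lemmas), so that only the NEW weighted (étale) content is declared here.
The rung: for WEIGHTED simple-branch (standard-étale) data `[Π[loᵢ,hiᵢ], A(x,h x)/B(x,h x)]` (`F(x,h) = 0`, `∂_w F(x,h) ≠ 0`, `B(x,h) ≠ 0` on the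
closed box, `F A B ∈ ℚ[x,w]`, `h` ℚ-Nash near the box) `[π]^K·[s] ∈ relations ⊔ ⟨rational closed-cube sector⟩` for every `K ≥ 1` — the gen-4
argument-principle chain with the contour form `ω = A·F_w/(B·F) dw`, whose residue at the simple real root is `A/B = s.integrand`.
[Kontsevich–Zagier 2001 §1.2; argument principle] Standard axioms, 0 sorry.
-/

noncomputable section

set_option linter.dupNamespace false

namespace Summit.KontsevichZagierPeriods.RootDecompRationalCubeDichotomy.RungEtale.Etale

open MeasureTheory Set MvPolynomial
open Literature.NumberTheory.Transcendental Literature.NumberTheory.Transcendental.KZ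
open Literature.ModelTheory.ExponentialFields (IsSemialgebraic analyticOnNhd_aeval continuous_aeval_real)
open Summit.KontsevichZagierPeriods.KontsevichZagierPeriods.Theses.RootDecompRationalCubeDichotomy
open Summit.KontsevichZagierPeriods.RootDecompRationalCubeDichotomy.Rung24903 (of_sub_of_mem_relations_of_fibreMap)
open Summit.KontsevichZagierPeriods.RootDecompRationalCubeDichotomy.Rung27842
open Summit.KontsevichZagierPeriods.RootDecompRationalCubeDichotomy.Rung27842.RootIso
open Summit.KontsevichZagierPeriods.RootDecompRationalCubeDichotomy.Rung27842.SimpleBranch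
open Summit.KontsevichZagierPeriods.RootDecompRationalCubeDichotomy.Rung24903
  (piRep_mul_mem_sup_of_mem_closure piRep_mul_mem_sup piIter_mem_sup isSemialgebraic_cubeLit)

/-- **Statement A-E PROVED**: uniform root isolation on a rational grid of sub-boxes + domain additivity
(the binder `F` of the proof is the isolating polynomial `D` of the statement). -/
theorem rootIsolationE_holds : RootIsolationE := by
  intro n g U s F hU hcU hsa hga hF0 hFz hsd
  have hgc : ContinuousOn g U := hga.continuousOn
  obtain ⟨δ, hδ, hiso⟩ := uniform_root_isolation hU hcU g hgc F hF0 hFz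
  have hcubec : IsCompact (Set.pi Set.univ (fun _ : Fin n => Set.Icc (0:ℝ) 1)) :=
    isCompact_univ_pi fun _ => isCompact_Icc
  have huc : UniformContinuousOn g (Set.pi Set.univ (fun _ : Fin n => Set.Icc (0:ℝ) 1)) :=
    hcubec.uniformContinuousOn_of_continuous (hgc.mono hcU)
  obtain ⟨ρ, hρ, hρg⟩ := Metric.uniformContinuousOn_iff.1 huc (δ / 8) (by positivity)
  obtain ⟨N, hN⟩ := exists_nat_gt (1 / ρ)
  have hNpos : (0:ℝ) < N := lt_trans (by positivity) hN
  have hN0 : 0 < N := by exact_mod_cast hNpos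
  have hmesh : (1:ℝ) / N < ρ := by
    rw [div_lt_iff₀ hNpos]
    calc (1:ℝ) = (1 / ρ) * ρ := by field_simp
      _ < N * ρ := mul_lt_mul_of_pos_right hN hρ
      _ = ρ * N := mul_comm _ _
  -- the grid of `Nⁿ` rational boxes
  let lo : (Fin n → Fin N) → Fin n → ℚ := fun κ i => ((κ i : ℕ) : ℚ) / N
  let hi : (Fin n → Fin N) → Fin n → ℚ := fun κ i => (((κ i : ℕ) : ℚ) + 1) / N
  let box : (Fin n → Fin N) → Set (Fin n → ℝ) := fun κ =>
    Set.pi Set.univ (fun i : Fin n => Icc ((lo κ i : ℚ) : ℝ) (hi κ i))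
  have hlo : ∀ κ i, ((lo κ i : ℚ) : ℝ) = ((κ i : ℕ) : ℝ) / (N : ℝ) := by intro κ i; simp [lo]
  have hhi : ∀ κ i, ((hi κ i : ℚ) : ℝ) = (((κ i : ℕ) : ℝ) + 1) / (N : ℝ) := by intro κ i; simp [hi]
  have hlohi : ∀ κ i, lo κ i < hi κ i := by
    intro κ i
    exact div_lt_div_of_pos_right (by linarith) (by exact_mod_cast hN0)
  have hbox_cube : ∀ κ, box κ ⊆ Set.pi Set.univ (fun _ : Fin n => Set.Icc (0:ℝ) 1) := by
    intro κ x hx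
    rw [Set.mem_univ_pi] at hx ⊢
    intro i
    have hxi := hx i
    rw [Set.mem_Icc, hlo, hhi] at hxi
    refine ⟨le_trans (by positivity) hxi.1, le_trans hxi.2 ?_⟩
    rw [div_le_one hNpos]
    have h := (κ i).isLt
    exact_mod_cast Nat.succ_le_of_lt h
  have hdist : ∀ κ, ∀ x ∈ box κ, ∀ y ∈ box κ, dist x y < ρ := by
    intro κ x hx y hy
    refine lt_of_le_of_lt ?_ hmesh
    refine (dist_pi_le_iff (by positivity)).2 fun i => ?_
    rw [Set.mem_univ_pi] at hx hy
    have hxi := hx i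
    have hyi := hy i
    rw [hlo, hhi] at hxi hyi
    refine (Real.dist_le_of_mem_Icc hxi hyi).trans (le_of_eq ?_)
    field_simp
    ring
  have hosc : ∀ κ, ∀ x ∈ box κ, ∀ y ∈ box κ, |g x - g y| < δ / 8 := by
    intro κ x hx y hy
    have := hρg x (hbox_cube κ hx) y (hbox_cube κ hy) (hdist κ x hx y hy)
    rwa [Real.dist_eq] at this
  -- every point of the cube lies in a grid box
  have hcover : ∀ x ∈ Set.pi Set.univ (fun _ : Fin n => Set.Icc (0:ℝ) 1), ∃ κ, x ∈ box κ := by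
    intro x hx
    rw [Set.mem_univ_pi] at hx
    refine ⟨fun i => ⟨min ⌊(N:ℝ) * x i⌋₊ (N - 1), by omega⟩, ?_⟩
    rw [Set.mem_univ_pi]
    intro i
    have hx0 : 0 ≤ x i := (hx i).1
    have hx1 : x i ≤ 1 := (hx i).2
    have hfl : (⌊(N:ℝ) * x i⌋₊ : ℝ) ≤ N * x i := Nat.floor_le (by positivity)
    have hfl' : (N:ℝ) * x i < ⌊(N:ℝ) * x i⌋₊ + 1 := Nat.lt_floor_add_one _
    have hcomm : x i * (N:ℝ) = N * x i := mul_comm _ _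
    simp only [Set.mem_Icc, hlo, hhi]
    constructor
    · rw [div_le_iff₀ hNpos]
      have hmin : ((min ⌊(N:ℝ) * x i⌋₊ (N - 1) : ℕ) : ℝ) ≤ ⌊(N:ℝ) * x i⌋₊ := by
        exact_mod_cast min_le_left _ _
      linarith
    · rw [le_div_iff₀ hNpos]
      by_cases hc : ⌊(N:ℝ) * x i⌋₊ ≤ N - 1
      · have hmin : ((min ⌊(N:ℝ) * x i⌋₊ (N - 1) : ℕ) : ℝ) = ⌊(N:ℝ) * x i⌋₊ := by
          rw [min_eq_left hc]
        rw [hmin]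
        linarith
      · push Not at hc
        have hmin : ((min ⌊(N:ℝ) * x i⌋₊ (N - 1) : ℕ) : ℝ) + 1 = N := by
          rw [min_eq_right hc.le, Nat.cast_sub (by omega), Nat.cast_one]; ring
        rw [hmin]
        nlinarith
  -- distinct grid boxes meet in a null set
  have hnull : ∀ κ κ', κ ≠ κ' → volume (box κ ∩ box κ') = 0 := by
    intro κ κ' hne
    obtain ⟨i, hi_ne⟩ := Function.ne_iff.1 hne
    have hset : box κ ∩ box κ' = Set.Icc (fun j => max ((lo κ j : ℚ) : ℝ) ((lo κ' j : ℚ) : ℝ))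
        (fun j => min ((hi κ j : ℚ) : ℝ) ((hi κ' j : ℚ) : ℝ)) := by
      ext x
      simp only [box, Set.mem_inter_iff, Set.mem_univ_pi, Set.mem_Icc, Pi.le_def, max_le_iff, le_min_iff]
      constructor
      · rintro ⟨h1, h2⟩; exact ⟨fun j => ⟨(h1 j).1, (h2 j).1⟩, fun j => ⟨(h1 j).2, (h2 j).2⟩⟩
      · rintro ⟨h1, h2⟩; exact ⟨fun j => ⟨(h1 j).1, (h2 j).1⟩, fun j => ⟨(h1 j).2, (h2 j).2⟩⟩
    rw [hset, Real.volume_Icc_pi]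
    refine Finset.prod_eq_zero (Finset.mem_univ i) ?_
    rw [ENNReal.ofReal_eq_zero]
    simp only [hlo, hhi]
    have hi_ne' : (κ i : ℕ) ≠ (κ' i : ℕ) := fun h => hi_ne (Fin.ext h)
    rcases Nat.lt_or_gt_of_ne hi_ne' with h | h
    · have h1 : ((κ i : ℕ) : ℝ) + 1 ≤ (κ' i : ℕ) := by exact_mod_cast h
      have h2 : (((κ i : ℕ) : ℝ) + 1) / N ≤ ((κ' i : ℕ) : ℝ) / N := div_le_div_of_nonneg_right h1 hNpos.le
      linarith [min_le_left ((((κ i : ℕ) : ℝ) + 1) / N) ((((κ' i : ℕ) : ℝ) + 1) / N),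
        le_max_right (((κ i : ℕ) : ℝ) / N) (((κ' i : ℕ) : ℝ) / N)]
    · have h1 : ((κ' i : ℕ) : ℝ) + 1 ≤ (κ i : ℕ) := by exact_mod_cast h
      have h2 : (((κ' i : ℕ) : ℝ) + 1) / N ≤ ((κ i : ℕ) : ℝ) / N := div_le_div_of_nonneg_right h1 hNpos.le
      linarith [min_le_right ((((κ i : ℕ) : ℝ) + 1) / N) ((((κ' i : ℕ) : ℝ) + 1) / N),
        le_max_left (((κ i : ℕ) : ℝ) / N) (((κ' i : ℕ) : ℝ) / N)]
  -- the pieces: restrictions of `s` to the grid boxes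
  have hbox_dom : ∀ κ, box κ ⊆ s.domain := fun κ => by rw [hsd]; exact hbox_cube κ
  let piece : (Fin n → Fin N) → IntegralRep n := fun κ =>
    s.restrict (box κ) (isSemialgebraic_ratBox (lo κ) (hi κ)) (hbox_dom κ)
  have hsum : of s - ∑ κ, of (piece κ) ∈ relations := by
    refine of_sub_sum_of_mem_relations (Finset.univ : Finset (Fin n → Fin N)) s piece ?_ ?_ ?_ ?_
    · intro κ _
      rw [Set.sdiff_eq_empty.2 (show (piece κ).domain ⊆ s.domain from hbox_dom κ), measure_empty]
    · intro κ _ z _; rfl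
    · rw [Set.sdiff_eq_empty.2 ?_, measure_empty]
      intro x hx
      rw [hsd] at hx
      obtain ⟨κ, hκ⟩ := hcover x hx
      exact Set.mem_iUnion₂.2 ⟨κ, Finset.mem_univ κ, hκ⟩
    · intro κ _ κ' _ hne
      exact hnull κ κ' hne
  -- the isolating rationals per box
  let x0 : (Fin n → Fin N) → Fin n → ℝ := fun κ i => ((lo κ i : ℚ) : ℝ)
  have hx0 : ∀ κ, x0 κ ∈ box κ := by
    intro κ
    rw [Set.mem_univ_pi]
    intro i
    refine ⟨le_rfl, ?_⟩
    show ((lo κ i : ℚ) : ℝ) ≤ ((hi κ i : ℚ) : ℝ)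
    exact_mod_cast (hlohi κ i).le
  have ha : ∀ κ : Fin n → Fin N, ∃ a : ℚ, g (x0 κ) - 3 * δ / 8 < a ∧ (a : ℝ) < g (x0 κ) - δ / 4 :=
    fun κ => exists_rat_btwn (by linarith)
  choose a ha1 ha2 using ha
  have hb : ∀ κ : Fin n → Fin N, ∃ b : ℚ, g (x0 κ) + δ / 4 < b ∧ (b : ℝ) < g (x0 κ) + 3 * δ / 8 :=
    fun κ => exists_rat_btwn (by linarith)
  choose b hb1 hb2 using hb
  obtain ⟨ε, hε1, hε2⟩ := exists_rat_btwn (show (0:ℝ) < δ / 8 by positivity)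
  obtain ⟨c, hc1, hc2⟩ := exists_rat_btwn (show δ / 8 < δ / 4 by linarith)
  have hIso : ∀ κ, (a κ < b κ ∧ 0 < ε ∧ ε < c ∧ (∀ x ∈ box κ, ((a κ : ℚ) : ℝ) + ((ε : ℚ) : ℝ) < g x ∧ g x + ((ε : ℚ) : ℝ) < ((b κ : ℚ) : ℝ)) ∧ (∀ x ∈ box κ, ∀ z : ℂ, ((a κ : ℚ) : ℝ) ≤ z.re → z.re ≤ ((b κ : ℚ) : ℝ) → |z.im| ≤ ((c : ℚ) : ℝ) → aeval (Fin.snoc (fun i => ((x i : ℝ) : ℂ)) z : Fin (n + 1) → ℂ) F = 0 → z = ((g x : ℝ) : ℂ))) := by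
    intro κ
    refine ⟨?_, ?_, ?_, ?_, ?_⟩
    · have h : ((a κ : ℚ) : ℝ) < b κ := by linarith [ha2 κ, hb1 κ]
      exact_mod_cast h
    · exact_mod_cast hε1
    · have h : ((ε : ℚ) : ℝ) < c := by linarith
      exact_mod_cast h
    · intro x hx
      have h := hosc κ x hx (x0 κ) (hx0 κ)
      rw [abs_lt] at h
      constructor <;> linarith [ha2 κ, hb1 κ, h.1, h.2]
    · intro x hx z hre1 hre2 him hz0
      by_contra hne
      have h := hosc κ x hx (x0 κ) (hx0 κ)
      rw [abs_lt] at h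
      have hnorm : ‖z - ((g x : ℝ) : ℂ)‖ ≤ δ := by
        refine (Complex.norm_le_abs_re_add_abs_im _).trans ?_
        simp only [Complex.sub_re, Complex.ofReal_re, Complex.sub_im, Complex.ofReal_im, sub_zero]
        have h1 : |z.re - g x| ≤ δ / 2 := by
          rw [abs_le]; constructor <;> linarith [ha1 κ, hb2 κ]
        have h2 : |z.im| ≤ δ / 4 := him.trans (by linarith)
        linarith
      exact hiso x (hbox_cube κ hx) z hne hnorm hz0
  -- assemble over `Fin (N ^ n)`
  let e : Fin (N ^ n) ≃ (Fin n → Fin N) := finFunctionFinEquiv.symm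
  have hs' : ∑ j : Fin (N ^ n), of (piece (e j)) = ∑ κ, of (piece κ) :=
    Equiv.sum_comp e (fun κ => of (piece κ))
  refine ⟨N ^ n, fun j => lo (e j), fun j => hi (e j), fun j => piece (e j), fun j => a (e j), fun j => b (e j),
    fun _ => c, fun _ => ε, fun j i => hlohi (e j) i, fun j => rfl, fun j => hbox_cube (e j),
    fun j z hz => rfl, ?_, fun j => hIso (e j)⟩
  rw [hs']
  exact hsum

/-- **S3-E `OuterInSectorE` HOLDS** (PROVED: `bind₁` presentation of `Re/Im h` on the constant-coordinate
edges + `band = box` + non-vanishing from `IsolatedOn`). -/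
theorem outerInSectorE_holds : OuterInSectorE := by
  intro n g U piece N F lo hi a b c ε hU hsub hg han hlohi hdom hiso BQ BP hBQ hBP
  have hab : a < b := hiso.1
  have hε : 0 < ε := hiso.2.1
  have hc : 0 < c := hiso.2.1.trans hiso.2.2.1
  have hmarg := hiso.2.2.2.1
  have hBQdom : ∀ z ∈ BQ.domain, Fin.init z ∈ piece.domain ∧ 0 ≤ z (Fin.last n) ∧ z (Fin.last n) ≤ (c:ℝ) := by
    intro z hz; rw [hBQ.1] at hz; exact ⟨hz.1, hz.2.1, hz.2.2⟩
  have hBPdom : ∀ z ∈ BP.domain, Fin.init z ∈ piece.domain ∧ (a:ℝ) ≤ z (Fin.last n) ∧ z (Fin.last n) ≤ (b:ℝ) := by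
    intro z hz; rw [hBP.1] at hz; exact ⟨hz.1, hz.2.1, hz.2.2⟩
  have hFb : ∀ z ∈ BQ.domain,
      aeval (ReIm.cplxPoint (Fin.snoc (Fin.snoc (Fin.init z) (b:ℝ) : Fin (n + 1) → ℝ) (z (Fin.last n)))) F ≠ 0 := by
    intro z hz
    obtain ⟨hx, h0, h1⟩ := hBQdom z hz
    refine aeval_cplxPoint_ne_zero_of_isolated hiso hx (by exact_mod_cast hab.le) le_rfl
      (by rw [abs_of_nonneg h0]; exact h1) ?_
    rintro ⟨hgb, -⟩
    have := (hmarg _ hx).2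
    have hε' : (0:ℝ) < ε := by exact_mod_cast hε
    linarith
  have hFa : ∀ z ∈ BQ.domain,
      aeval (ReIm.cplxPoint (Fin.snoc (Fin.snoc (Fin.init z) (a:ℝ) : Fin (n + 1) → ℝ) (z (Fin.last n)))) F ≠ 0 := by
    intro z hz
    obtain ⟨hx, h0, h1⟩ := hBQdom z hz
    refine aeval_cplxPoint_ne_zero_of_isolated hiso hx le_rfl (by exact_mod_cast hab.le)
      (by rw [abs_of_nonneg h0]; exact h1) ?_
    rintro ⟨hga, -⟩
    have := (hmarg _ hx).1
    have hε' : (0:ℝ) < ε := by exact_mod_cast hε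
    linarith
  have hFc : ∀ z ∈ BP.domain, aeval (ReIm.cplxPoint (Fin.snoc z (c:ℝ) : Fin (n + 2) → ℝ)) F ≠ 0 := by
    intro z hz
    obtain ⟨hx, h0, h1⟩ := hBPdom z hz
    have hz' : (Fin.snoc z (c:ℝ) : Fin (n + 2) → ℝ) =
        Fin.snoc (Fin.snoc (Fin.init z) (z (Fin.last n)) : Fin (n + 1) → ℝ) (c:ℝ) := by
      rw [Fin.snoc_init_self]
    rw [hz']
    refine aeval_cplxPoint_ne_zero_of_isolated hiso hx h0 h1 (by rw [abs_of_pos (by exact_mod_cast hc)]) ?_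
    rintro ⟨-, hc0⟩
    have hc' : (0:ℝ) < c := by exact_mod_cast hc
    exact hc'.ne' hc0
  have hbandQ := band_box_const lo hi 0 c
  simp only [Rat.cast_zero] at hbandQ
  refine ⟨⟨n + 1, BQ, Fin.snoc lo 0, Fin.snoc hi c,
      bind₁ (substU n b) (ReA (N) F) * bind₁ (substU n a) (Bsq F) -
        bind₁ (substU n a) (ReA (N) F) * bind₁ (substU n b) (Bsq F),
      bind₁ (substU n b) (Bsq F) * bind₁ (substU n a) (Bsq F), snoc_lt_snoc hlohi hc, ?_, ?_, ?_, rfl⟩,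
    ⟨n + 1, BP, Fin.snoc lo a, Fin.snoc hi b, bind₁ (substV n c) (ImA (N) F), bind₁ (substV n c) (Bsq F),
      snoc_lt_snoc hlohi hab, ?_, ?_, ?_, rfl⟩⟩
  · rw [hBQ.1, hdom, hbandQ]
  · intro z hz
    rw [map_mul, aeval_substU, aeval_substU]
    exact mul_ne_zero (aeval_Bsq_ne_zero F _ (hFb z hz)) (aeval_Bsq_ne_zero F _ (hFa z hz))
  · intro z hz
    rw [hBQ.2 z hz, ratRe_eq', ratRe_eq', map_mul, map_sub, map_mul, map_mul, aeval_substU, aeval_substU,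
      aeval_substU, aeval_substU,
      div_sub_div _ _ (aeval_Bsq_ne_zero F _ (hFb z hz)) (aeval_Bsq_ne_zero F _ (hFa z hz))]
    ring
  · rw [hBP.1, hdom, band_box_const]
  · intro z hz
    rw [aeval_substV]
    exact aeval_Bsq_ne_zero F _ (hFc z hz)
  · intro z hz
    rw [hBP.2 z hz, ratIm_eq', aeval_substV, aeval_substV]

end Summit.KontsevichZagierPeriods.RootDecompRationalCubeDichotomy.RungEtale.Etale
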